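import Literature.Algebra.Lie.LefschetzDomainSpan
import HarnessLib

/-!
# `(𝔤, h)` is a Jordan–Lefschetz pair iff `(𝔤, -h)` is: the roles of `𝔤_2` and `𝔤_{-2}` are symmetric (Looijenga–Lunts 1997, §1–§3 sign conventions)

Topic `Literature/Algebra/Lie` (namespace `Literature.Algebra.Lie`).  Lane `lit-hodgefound` (Track 2 foundations library),
skeleton seat `lit-hodgefound-skel-1` (generation 51), row **A1-202** of `run/shared/lean/pub/lit-hodgefound/SKELETON.md`.
Looijenga–Lunts grade `𝔰𝔬(V ⊕ V^*)` in (3.1) by `u = (-1_V, +1_{V^*})` and in (2.9) by "the element with the eigen space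
decomposition `V_{-1} ⊕ V_1`"; rows A1-190/191/192 use `h = (1 0; 0 -1)` "up to the order of the two summands", i.e. up
to `h ↦ -h`.  This file makes that harmless: for a Jordan–Lefschetz pair `(𝔤, h)` the pair `(𝔤, -h)` is again
Jordan–Lefschetz (`𝔤_c(-h) = 𝔤_{-c}(h)`; `𝔤_{-2}` is abelian by (2.1); every `𝔰𝔩₂`-triple `(e, h, f)` gives the triple
`(f, -h, e)`; and `𝔤_{-2} ∪ dom f` generates `𝔤` because `dom f` spans `𝔤_2`, row A1-111).  THEOREMS ONLY (no definition,
no named fact, no `sorry`; net debt `0`).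

## Source, VERBATIM

E. Looijenga, V. A. Lunts, *A Lie algebra attached to a projective variety*, Invent. Math. **129** (1997) 361–412 (held
TeX `paper:arxiv-alg-geom_9604014`): §1 (1.1) p0004 L28–L35 ("`f` … is a rational map; its domain is open (dense)");
§1 p0007 L54–L78 (Lefschetz triple, "(ii) `𝔤` is as a Lie algebra generated by `𝔞` and the image of `f`"); §2 (2.1) p0009
L81–L94 ("(i) `𝔤` has only degrees `-2`, `0` and `2`, (ii) `𝔤_{-2}` is abelian … We only prove the nontrivial implication
(ii) ⇒ (i)"); (2.9) p0010 L82–L110, p0011 L1–L8 ("let `h` … be the element with the eigen space decomposition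
`V_{-1} ⊕ V_1`"); §3 (3.1) p0013 L43–L47 ("The semi-simple element `u := (-1_V, +1_{V^*}) ∈ 𝔰𝔬(V ⊕ V^*)` defines a
grading of the latter with degrees `2`, `0` and `-2`").

## Contents (all proved)

* `mem_lefschetzDuals_neg_of_mem_lefschetzDomain` (`dom f(h) ⊆ im f(-h)`; with row A1-101's `adDegree_neg`, row A1-84's `f_mem_adDegree`);
* **`IsJordanLefschetzPair.neg`**: `(𝔤, h)` Jordan–Lefschetz ⟹ `(𝔤, -h)` Jordan–Lefschetz (characteristic `0`, `𝔤`
  finite-dimensional); **`isJordanLefschetzPair_neg_iff`**; `IsJordanLefschetzPair.isLefschetzPair_neg`.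
-/

namespace Literature.Algebra.Lie

variable {K : Type*} [Field K] {L : Type*} [LieRing L] [LieAlgebra K L] {h : L}

/-- `dom f(h) ⊆ im f(-h)`: a Lefschetz element `e ∈ 𝔤_2(h)` with partner `f` is the partner of `f ∈ 𝔤_2(-h)` for the
triple `(f, -h, e)`. [cite: LooijengaLunts1997, §1 (1.1) p0004 L28–L35, §1 p0007 L54–L66] -/
theorem mem_lefschetzDuals_neg_of_mem_lefschetzDomain {e : L} (he : e ∈ lefschetzDomain K h (adDegree K h 2)) :
    e ∈ lefschetzDuals K (-h) (adDegree K (-h) 2) := by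
  obtain ⟨-, f, t⟩ := he
  refine ⟨f, ?_, t.symm⟩
  rw [adDegree_neg]
  exact f_mem_adDegree t

variable [CharZero K] [FiniteDimensional K L]

/-- **`(𝔤, h)` Jordan–Lefschetz ⟹ `(𝔤, -h)` Jordan–Lefschetz.**  `𝔤_2(-h) = 𝔤_{-2}(h)` is abelian ((2.1)); for a
Lefschetz `e ∈ 𝔤_2(h)` with partner `f`, `(f, -h, e)` is an `𝔰𝔩₂`-triple, so `f ∈ dom f(-h)`; and the Lie algebra
generated by `𝔤_{-2}(h)` and these `e` contains `span (dom f(h)) = 𝔤_2(h)` (row A1-111) and the image of `f`, hence is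
`𝔤`. [cite: LooijengaLunts1997, §2 (2.1) p0009 L81–L94, §1 p0007 L54–L78, (1.1) p0004 L28–L35; §3 (3.1) p0013 L43–L47] -/
theorem IsJordanLefschetzPair.neg (J : IsJordanLefschetzPair K h) : IsJordanLefschetzPair K (-h) := by
  have T := J.isLefschetzTriple
  refine ⟨J.isSemisimple, le_rfl, fun x hx y hy ↦ ?_, ?_, ?_⟩
  · rw [adDegree_neg] at hx hy
    exact J.lie_eq_zero_of_mem_adDegree_neg_two hx hy
  · obtain ⟨e, he⟩ := T.nonempty_lefschetzDomain
    obtain ⟨he2, f, t⟩ := he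
    refine ⟨f, ?_, e, t.symm⟩
    rw [adDegree_neg]
    exact f_mem_adDegree t
  · rw [eq_top_iff, ← J.lieSpan_eq_top, LieSubalgebra.lieSpan_le]
    rintro x (hx | hx)
    · -- `𝔤_2(h) = span (dom f(h)) ⊆ S'`, since `dom f(h) ⊆ im f(-h) ⊆ S'`
      have hx' : x ∈ Submodule.span K (lefschetzDomain K h (adDegree K h 2)) := by
        rw [T.span_lefschetzDomain]; exact hx
      have hle : Submodule.span K (lefschetzDomain K h (adDegree K h 2)) ≤
          (LieSubalgebra.lieSpan K L
            ((adDegree K (-h) 2 : Set L) ∪ lefschetzDuals K (-h) (adDegree K (-h) 2))).toSubmodule := by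
        rw [Submodule.span_le]
        intro e he
        exact LieSubalgebra.subset_lieSpan (Or.inr (mem_lefschetzDuals_neg_of_mem_lefschetzDomain he))
      exact hle hx'
    · -- `im f(h) ⊆ 𝔤_{-2}(h) = 𝔤_2(-h) ⊆ S'`
      refine LieSubalgebra.subset_lieSpan (Or.inl ?_)
      rw [SetLike.mem_coe, adDegree_neg]
      exact lefschetzDuals_subset_adDegree hx

/-- **`(𝔤, -h)` is a Jordan–Lefschetz pair iff `(𝔤, h)` is.** [cite: LooijengaLunts1997, §2 (2.1) p0009 L81–L94, §3 (3.1) p0013 L43–L47] -/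
theorem isJordanLefschetzPair_neg_iff : IsJordanLefschetzPair K (-h) ↔ IsJordanLefschetzPair K h :=
  ⟨fun J ↦ by simpa using J.neg, fun J ↦ J.neg⟩

/-- In particular `(𝔤, -h)` is a Lefschetz pair. [cite: LooijengaLunts1997, §1 p0007 L54–L78] -/
theorem IsJordanLefschetzPair.isLefschetzPair_neg (J : IsJordanLefschetzPair K h) : IsLefschetzPair K (-h) :=
  J.neg.isLefschetzPair

end Literature.Algebra.Lie
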